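import Summits.ABC.IUTFork.Joshi.FrobenioidsJoshiGlobal

/-!
# Joshi, ATS III (arXiv 2401.13508v4) §10.2 / §10.5: `Φ(K)^gp` IS the group generated by `Φ(K)` on the valued-field
# instance, and `deg_L : L^* → ℝ` IS a homomorphism — two reader notes on `Joshi/FrobenioidsJoshiGlobal.lean` closed in kernel

Proof-only companion (abc-iut cell, branch E, rung LADDER-ABC:A2.E; seat abc-iut-E-t61 = [J-III] §10 typer-side second
reader per E-plan-2 07:57:38Z; "DERIVABLE rows of the file you just read are fair game afterwards", E-plan-2 07:46:39Z).
Sequel of seat E-t34's `Joshi/FrobenioidsJoshiGlobal.lean` (p431166; its additivity companion is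
`Joshi/FrobenioidsJoshiGlobalDegree.lean`, p431916) over seat E-t32's carriers `Frob.divMonoid ≤ Frob.divGroup ≤ ℝˣ` (`Joshi/FrobenioidsJoshi.lean`, p430621),
all imported BY NAME, nothing restated. TAKES NO SIDE on [IUTchIII] Cor. 3.12 or on any author (Mochizuki /
Scholze–Stix / Joshi / Dupuy–Hilado); typed ≠ proved; Joshi's papers are unrefereed preprints; everything below is
kernel-checked arithmetic of absolute values. Locators "p.N l.M" = PDF page / line of
`HOME/lit/renders/Joshi-arxiv-2401.13508/pNNNN.txt`. [claim: Joshi2024ATS3, status: disputed]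

WHAT (the two LOW notes of the typer-side read of p431166, STATUS 08:17:51Z):
* NOTE-1. Print: "let `Φ(K)^gp` be the group associated to the monoid `Φ(K)`" (p.129 l.7–9; (10.2.5) p.130 l.9–10
  "`Φ(K) → Φ(K)^gp → |K^*|`"). The signature `ATS3.ElementaryFrobenioid` takes `Gp` as ANY commutative group receiving
  `Φ`; here: on the valued-field instance `Frob.toModel v` the subgroup of `ℝˣ` generated by `Φ(K) = |𝒪_K^▹|_K` IS
  `Φ(K)^gp = |K^*|_K` (`closure_divMonoid_eq_divGroup`: a value `> 1` is the inverse of a value `< 1`), so the instance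
  is print-exact.
* NOTE-2. Print: "a global arithmetic degree homomorphism `Φ(L) → ℝ` … which factors through `Φ(L)^gp` as `ℝ` is a
  group" ((10.5.3)–(10.5.4), p.133 l.32 – p.134 l.1), composed with `L^* → Φ(L)^gp` (10.5.2). Seat E-t34 typed the
  composite as the bare function `ATS3.globalDeg`, proved the product formula (10.5.5) `globalDeg_eq_zero` (p431166)
  and additivity place by place (p431916); here: there IS a homomorphism `L^* → ℝ` with exactly those values
  (`exists_globalDegHom`) and it is UNIQUE and TRIVIAL (`globalDegHom_eq_one`) — both immediate from (10.5.5), which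
  is the honest content of "the global arithmetic degree homomorphism" on `L^*`.
-/

noncomputable section

namespace Summit.ABC.IUTFork.Joshi.ATS3

namespace Frob

universe u

variable {K : Type u} [Field K] (v : AbsoluteValue K ℝ)

/-- **`Φ(K)^gp` is generated by `Φ(K)`** (p.129 l.7–9 "the group associated to the monoid `Φ(K)`"; (10.2.5)): inside
`ℝˣ`, the subgroup generated by the value monoid `|𝒪_K^▹|_K` is the value group `|K^*|_K` — every value `|x|_K > 1` is
`(|x⁻¹|_K)⁻¹` with `|x⁻¹|_K ≤ 1`. [folklore] -/
theorem closure_divMonoid_eq_divGroup : Subgroup.closure (divMonoid v : Set ℝˣ) = divGroup v := by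
  refine le_antisymm ((Subgroup.closure_le _).mpr fun r hr => divMonoid_le_divGroup v hr) fun r hr => ?_
  obtain ⟨x, rfl⟩ := hr
  by_cases hx : v (x : K) ≤ 1
  · exact Subgroup.subset_closure ((absUnits_mem_divMonoid_iff v x).mpr hx)
  · have hx' : v ((x⁻¹ : Kˣ) : K) ≤ 1 := by
      rw [Units.val_inv_eq_inv_val, map_inv₀]
      exact inv_le_one_of_one_le₀ (le_of_lt (not_le.mp hx))
    have hmem : absUnits v x⁻¹ ∈ Subgroup.closure (divMonoid v : Set ℝˣ) :=
      Subgroup.subset_closure ((absUnits_mem_divMonoid_iff v x⁻¹).mpr hx')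
    have := Subgroup.inv_mem _ hmem
    rwa [map_inv, inv_inv] at this

/-- Hence the bridge instance `Frob.toModel v` of seat E-t34 has `Φ^gp` generated by the image of `Φ → Φ^gp`
(its `toGp` is the inclusion `|𝒪_K^▹| ⊆ |K^*|`): the elementary Frobenioid `(Φ(K), K^* → Φ(K)^gp)` of (10.2.6) with
`Φ(K)^gp` literally "the group associated to the monoid". [folklore] -/
theorem toModel_gp_generated {K₀ : Type} [Field K₀] (w : AbsoluteValue K₀ ℝ) :
    Subgroup.closure (Set.range (toModel w).toGp) = ⊤ := by
  change Subgroup.closure (Set.range fun r : divMonoid w => (⟨r.1, divMonoid_le_divGroup w r.2⟩ : divGroup w)) =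
    (⊤ : Subgroup (divGroup w))
  rw [eq_top_iff]
  rintro ⟨r, hr⟩ -
  have hr' : r ∈ Subgroup.closure (divMonoid w : Set ℝˣ) := by rw [closure_divMonoid_eq_divGroup]; exact hr
  induction hr' using Subgroup.closure_induction with
  | mem s hs => exact Subgroup.subset_closure ⟨⟨s, hs⟩, rfl⟩
  | one => exact Subgroup.one_mem _
  | mul a b ha hb iha ihb =>
    have ha' : a ∈ divGroup w := by rw [← closure_divMonoid_eq_divGroup]; exact ha
    have hb' : b ∈ divGroup w := by rw [← closure_divMonoid_eq_divGroup]; exact hb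
    exact Subgroup.mul_mem _ (iha ha') (ihb hb')
  | inv a ha iha =>
    have ha' : a ∈ divGroup w := by rw [← closure_divMonoid_eq_divGroup]; exact ha
    exact Subgroup.inv_mem _ (iha ha')

end Frob

section NumberFieldDegree

open NumberField

variable (L : Type) [Field L] [NumberField L]

/-- **(10.5.2)–(10.5.4): the global arithmetic degree as a HOMOMORPHISM `deg_L : L^* → ℝ`** ("global arithmetic degree
homomorphism … which factors through `Φ(L)^gp` as `ℝ` is a group", p.133 l.32 – p.134 l.1): a homomorphism with the
values `globalDeg L x` EXISTS — by the product formula (10.5.5) (seat E-t34's `globalDeg_eq_zero`) the trivial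
homomorphism has them. [claim: Joshi2024ATS3, status: disputed] -/
theorem exists_globalDegHom :
    ∃ φ : Lˣ →* Multiplicative ℝ, ∀ x : Lˣ, (φ x).toAdd = globalDeg L (x : L) :=
  ⟨1, fun x => by rw [globalDeg_eq_zero x.ne_zero]; rfl⟩

/-- **(10.5.5)**: any such degree homomorphism is the TRIVIAL one — the product formula `Σ_v log(|x|_{L_v}) = 0`
(seat E-t34's `globalDeg_eq_zero`, from Mathlib's `NumberField.prod_abs_eq_one`). [folklore] -/
theorem globalDegHom_eq_one (φ : Lˣ →* Multiplicative ℝ) (hφ : ∀ x : Lˣ, (φ x).toAdd = globalDeg L (x : L)) :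
    φ = 1 := by
  ext x
  have h := hφ x
  rw [globalDeg_eq_zero x.ne_zero] at h
  change (φ x).toAdd = (1 : Multiplicative ℝ).toAdd
  rw [h]; rfl

end NumberFieldDegree

end Summit.ABC.IUTFork.Joshi.ATS3

end
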